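import Mathlib.Analysis.Real.Pi.Wallis
import Mathlib.NumberTheory.ZetaValues
import Literature.NumberTheory.LFunctions.AlternativeHypothesisTheorem3Assembly
import HarnessLib

/-!
# BGSTB 2025, Corollary 4 (ii)–(iv): the closed-form constants (`∫_1^∞ s(α)/α² dα`, `Σ 1/(2n)²`, `Σ 1/(2n−1)²`)

Topic `Literature/NumberTheory/LFunctions` (namespace `Literature.NumberTheory.LFunctions.AH.Cor4`).
Theorems only: no definition, no named fact. LABEL (cell rh-crit, corpus C5): NOT RH-BEARING — elementary real
analysis (Wallis' product, `ζ(2)`); nothing here bears on the truth of RH.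

Baluyot–Goldston–Suriajaya–Turnage-Butterbaugh 2025 (arXiv:2508.10857), §7, proof of Corollary 4 (ii)
(TeX l.1111–1146): "Applying Theorem 3 to the interval `[1,U]`, with `U ∉ ℤ`, we have
`∫_1^U 𝓕(α)/α² dα = ∑_{n, 2n+1<U} (∫_{2n−1}^{2n} (2n−α)/α² dα + ∫_{2n}^{2n+1} (α−2n)/α² dα + 2(P_0−1)/(2n−1)² + 1/(2n)²) + O(U^{−2})
= … = ∑_{n=1}^∞ (1/(2n−1) − 1/(2n+1)) + ∑_{n=1}^∞ log(1 − 1/(4n²)) + (3/2(P_0−1) + 1/4) ζ(2) + O(U^{−1})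
= 1 + (3/2(P_0−1) + 1/4) π²/6 + ∑_{n=1}^∞ log(1 − 1/(4n²)) + O(U^{−1})`" and "Recalling
`sin z/z = ∏_{n=1}^∞ (1 − z²/(nπ)²)`, we have `∑_{n=1}^∞ log(1 − 1/(4n²)) = log ∏_{n=1}^∞ (1 − 1/(4n²)) = log(2/π)`."

This module proves the closed forms used there (our route for the last one is Mathlib's Wallis product
`Real.Wallis.tendsto_W_nhds_pi_div_two`, `∏_{n≤N} 4n²/(4n²−1) → π/2`, rather than the sine product):

* `AH.Cor4.integral_triangleWave_div_sq_period` — per period, `n ≥ 1`: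
  `∫_{2n−1}^{2n+1} s(α)/α² dα = (1/(2n−1) − 1/(2n+1)) + log(1 − 1/(4n²))`;
* `AH.Cor4.integral_triangleWave_div_sq_eq` — `∫_1^{2N+1} s(α)/α² dα = (1 − 1/(2N+1)) − log W_N`
  (`W_N = Real.Wallis.W N`);
* `AH.Cor4.tendsto_integral_triangleWave_div_sq` — **`∫_1^U s(α)/α² dα → 1 + log(2/π)`** as `U → ∞`;
* `AH.Cor4.hasSum_one_div_even_sq` — `Σ_{n≥1} 1/(2n)² = π²/24` (= `ζ(2)/4`);
  `AH.Cor4.hasSum_one_div_odd_sq` — `Σ_{n≥1} 1/(2n−1)² = π²/8` (= `3ζ(2)/4`);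
* `AH.Cor4.corollary4_constant` — the assembly
  `2(p_0−1)·π²/8 + π²/24 + (1 + log(2/π)) = 1 + (3/2(p_0−1) + 1/4) π²/6 + log(2/π)`;
* `AH.Cor4.tendsto_sum_Ioo_even` / `AH.Cor4.tendsto_sum_Ioo_odd` — the atom sums in the exact shape of
  `AH.calFIntegral P₀ 1 U g` (`⌈U⌉ = N + 1`, `g(m) = 1/m²`): `→ π²/24` and `→ π²/8 − 1` as `N → ∞`.

These are the inputs of the deduction Theorem 3 ⇒ Corollary 4 (ii)–(iv) (typed claim `bgstb2025_corollary4`,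
`AlternativeHypothesisFormFactor.lean`); that deduction itself (the tail `∫_U^∞ F/α² ≪ 1/U` and the exchange
of limits) is not done here.

## References

* [BaluyotGoldstonSuriajayaTurnageButterbaugh2025] arXiv:2508.10857, Corollary 4; §7 (proof of Corollary 4),
  TeX l.1111–1146. [claim: BaluyotGoldstonSuriajayaTurnageButterbaugh2025, status: under-review]
* [LagariasRodgers2020] §2.3 (2.3) (the sawtooth `s`).
-/

noncomputable section

open MeasureTheory Filter Set Topology
open scoped Topology Interval Real

namespace Literature.NumberTheory.LFunctions.AH.Cor4

/-! ### The sawtooth on one period -/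

/-- On the period around the even integer `2n`: `s(α) = |α − 2n|` for `|α − 2n| ≤ 1` ((calF): "`s(α) = |α|`
for `|α| ≤ 1`, and `s(α + 2) = s(α)`"). [cite: BaluyotGoldstonSuriajayaTurnageButterbaugh2025, §2 (calF)] -/
theorem triangleWave_eq_abs_sub (n : ℕ) {α : ℝ} (h : |α - 2 * n| ≤ 1) : triangleWave α = |α - 2 * n| := by
  have e := triangleWave_add_two_mul_int (α - 2 * n) (n : ℤ)
  rw [show α - 2 * (n : ℝ) + 2 * ((n : ℤ) : ℝ) = α by push_cast; ring] at e
  rw [e, triangleWave_of_abs_le_one h]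

/-! ### The per-period integral -/

/-- An antiderivative of `(c − α)/α²` on `(0, ∞)`: `α ↦ −c/α − log α`. [folklore] -/
private theorem hasDerivAt_left (c : ℝ) {x : ℝ} (hx : 0 < x) :
    HasDerivAt (fun α : ℝ ↦ -c / α - Real.log α) ((c - x) / x ^ 2) x := by
  have h1 : HasDerivAt (fun α : ℝ ↦ α⁻¹) (-(x ^ 2)⁻¹) x := hasDerivAt_inv hx.ne'
  have h2 : HasDerivAt (fun α : ℝ ↦ Real.log α) x⁻¹ x := Real.hasDerivAt_log hx.ne'
  have h3 := (h1.const_mul (-c)).sub h2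
  have hx0 : x ≠ 0 := hx.ne'
  have hval : -c * -(x ^ 2)⁻¹ - x⁻¹ = (c - x) / x ^ 2 := by field_simp
  rw [hval] at h3
  have hfun : (fun α : ℝ ↦ -c / α - Real.log α) = (fun y : ℝ ↦ -c * y⁻¹) - fun α ↦ Real.log α := by
    funext α; simp only [Pi.sub_apply]; ring
  rw [hfun]
  exact h3

/-- An antiderivative of `(α − c)/α²` on `(0, ∞)`: `α ↦ log α + c/α`. [folklore] -/
private theorem hasDerivAt_right (c : ℝ) {x : ℝ} (hx : 0 < x) :
    HasDerivAt (fun α : ℝ ↦ Real.log α + c / α) ((x - c) / x ^ 2) x := by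
  have h1 : HasDerivAt (fun α : ℝ ↦ α⁻¹) (-(x ^ 2)⁻¹) x := hasDerivAt_inv hx.ne'
  have h2 : HasDerivAt (fun α : ℝ ↦ Real.log α) x⁻¹ x := Real.hasDerivAt_log hx.ne'
  have h3 := h2.add (h1.const_mul c)
  have hx0 : x ≠ 0 := hx.ne'
  have hval : x⁻¹ + c * -(x ^ 2)⁻¹ = (x - c) / x ^ 2 := by field_simp; ring
  rw [hval] at h3
  have hfun : (fun α : ℝ ↦ Real.log α + c / α) = (fun α : ℝ ↦ Real.log α) + fun y ↦ c * y⁻¹ := by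
    funext α; simp only [Pi.add_apply]; ring
  rw [hfun]
  exact h3

/-- **The period integral** (BGSTB 2025, §7, proof of Corollary 4 (ii):
"`∫_{2n−1}^{2n} (2n−α)/α² dα + ∫_{2n}^{2n+1} (α−2n)/α² dα`" evaluated as
"`(1/(2n−1) − 1/(2n+1)) + log(1 − 1/(4n²))`"): for `n ≥ 1`,
`∫_{2n−1}^{2n+1} s(α)/α² dα = (1/(2n−1) − 1/(2n+1)) + log(1 − 1/(4n²))`.
[cite: BaluyotGoldstonSuriajayaTurnageButterbaugh2025, §7 (proof of Corollary 4)] -/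
theorem integral_triangleWave_div_sq_period (n : ℕ) (hn : 1 ≤ n) :
    ∫ α in (2 * n - 1 : ℝ)..(2 * n + 1), triangleWave α / α ^ 2 =
      (1 / (2 * n - 1) - 1 / (2 * n + 1)) + Real.log (1 - 1 / (4 * n ^ 2)) := by
  have hn1 : (1 : ℝ) ≤ n := by exact_mod_cast hn
  set c : ℝ := 2 * n with hc
  have hc1 : 1 ≤ c - 1 := by linarith
  have hc0 : 0 < c := by linarith
  -- continuity of the integrand away from `0`
  have hcont : ∀ a b : ℝ, 0 < a → a ≤ b → ContinuousOn (fun α : ℝ ↦ triangleWave α / α ^ 2) (uIcc a b) := by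
    intro a b ha hab
    rw [uIcc_of_le hab]
    exact AH.Thm3.continuous_triangleWave.continuousOn.div (continuousOn_pow 2)
      fun x hx ↦ pow_ne_zero 2 (by linarith [hx.1] : x ≠ 0)
  have hI1 : IntervalIntegrable (fun α : ℝ ↦ triangleWave α / α ^ 2) volume (c - 1) c :=
    (hcont (c - 1) c (by linarith) (by linarith)).intervalIntegrable
  have hI2 : IntervalIntegrable (fun α : ℝ ↦ triangleWave α / α ^ 2) volume c (c + 1) :=
    (hcont c (c + 1) hc0 (by linarith)).intervalIntegrable
  -- the sawtooth on the two half-periods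
  have e1 : ∫ α in (c - 1)..c, triangleWave α / α ^ 2 = ∫ α in (c - 1)..c, (c - α) / α ^ 2 := by
    refine intervalIntegral.integral_congr fun α hα ↦ ?_
    rw [uIcc_of_le (by linarith)] at hα
    have habs : |α - 2 * n| ≤ 1 := by rw [← hc, abs_le]; constructor <;> linarith [hα.1, hα.2]
    rw [triangleWave_eq_abs_sub n habs, ← hc, abs_of_nonpos (by linarith [hα.2]), neg_sub]
  have e2 : ∫ α in c..(c + 1), triangleWave α / α ^ 2 = ∫ α in c..(c + 1), (α - c) / α ^ 2 := by
    refine intervalIntegral.integral_congr fun α hα ↦ ?_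
    rw [uIcc_of_le (by linarith)] at hα
    have habs : |α - 2 * n| ≤ 1 := by rw [← hc, abs_le]; constructor <;> linarith [hα.1, hα.2]
    rw [triangleWave_eq_abs_sub n habs, ← hc, abs_of_nonneg (by linarith [hα.1])]
  -- the two elementary integrals
  have v1 : ∫ α in (c - 1)..c, (c - α) / α ^ 2 =
      (-c / c - Real.log c) - (-c / (c - 1) - Real.log (c - 1)) := by
    refine intervalIntegral.integral_eq_sub_of_hasDerivAt (fun x hx ↦ hasDerivAt_left c ?_) ?_
    · rw [uIcc_of_le (by linarith)] at hx; linarith [hx.1]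
    · refine (ContinuousOn.div ?_ (continuousOn_pow 2) fun x hx ↦ ?_).intervalIntegrable
      · fun_prop
      · rw [uIcc_of_le (by linarith)] at hx
        exact pow_ne_zero 2 (by linarith [hx.1] : x ≠ 0)
  have v2 : ∫ α in c..(c + 1), (α - c) / α ^ 2 =
      (Real.log (c + 1) + c / (c + 1)) - (Real.log c + c / c) := by
    refine intervalIntegral.integral_eq_sub_of_hasDerivAt (fun x hx ↦ hasDerivAt_right c ?_) ?_
    · rw [uIcc_of_le (by linarith)] at hx; linarith [hx.1]
    · refine (ContinuousOn.div ?_ (continuousOn_pow 2) fun x hx ↦ ?_).intervalIntegrable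
      · fun_prop
      · rw [uIcc_of_le (by linarith)] at hx
        exact pow_ne_zero 2 (by linarith [hx.1] : x ≠ 0)
  have hsplit : ∫ α in (2 * n - 1 : ℝ)..(2 * n + 1), triangleWave α / α ^ 2 =
      (∫ α in (c - 1)..c, triangleWave α / α ^ 2) + ∫ α in c..(c + 1), triangleWave α / α ^ 2 := by
    rw [hc, intervalIntegral.integral_add_adjacent_intervals (by rw [← hc]; exact hI1)
      (by rw [← hc]; exact hI2)]
  rw [hsplit, e1, e2, v1, v2]
  -- the logarithm of `1 − 1/(4n²) = (c−1)(c+1)/c²`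
  have hlog : Real.log (1 - 1 / (4 * n ^ 2)) = Real.log (c - 1) + Real.log (c + 1) - 2 * Real.log c := by
    have e : (1 : ℝ) - 1 / (4 * n ^ 2) = (c - 1) * (c + 1) / c ^ 2 := by
      rw [hc]; field_simp; ring
    rw [e, Real.log_div (by positivity) (by positivity), Real.log_mul (by positivity) (by positivity),
      Real.log_pow]
    push_cast
    ring
  rw [hlog]
  have e3 : -c / c = -1 := by field_simp
  have e4 : c / c = 1 := by field_simp
  rw [e3, e4]
  have hc1' : c - 1 ≠ 0 := by linarith
  have hc2' : c + 1 ≠ 0 := by linarith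
  field_simp
  ring


/-! ### Summing the periods: `∫_1^{2N+1} s/α²` and Wallis' product -/

/-- The integrand `s(α)/α²` is interval integrable on every `[a, b]` with `0 < a ≤ b`. [folklore] -/
private theorem intervalIntegrable_triangleWave_div_sq {a b : ℝ} (ha : 0 < a) (hab : a ≤ b) :
    IntervalIntegrable (fun α : ℝ ↦ triangleWave α / α ^ 2) volume a b := by
  refine (ContinuousOn.div AH.Thm3.continuous_triangleWave.continuousOn (continuousOn_pow 2)
    fun x hx ↦ ?_).intervalIntegrable
  rw [uIcc_of_le hab] at hx
  exact pow_ne_zero 2 (by linarith [hx.1] : x ≠ 0)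

/-- **`∫_1^{2N+1} s(α)/α² dα = (1 − 1/(2N+1)) − log W_N`**, `W_N = ∏_{n≤N} 4n²/(4n²−1)` Mathlib's Wallis
partial product (`Real.Wallis.W`): the telescoping "`∑ (1/(2n−1) − 1/(2n+1))`" and
"`∑ log(1 − 1/(4n²)) = log ∏ (1 − 1/(4n²))`" of §7, proof of Corollary 4 (ii), at finite `N`.
[cite: BaluyotGoldstonSuriajayaTurnageButterbaugh2025, §7 (proof of Corollary 4)] -/
theorem integral_triangleWave_div_sq_eq (N : ℕ) :
    ∫ α in (1 : ℝ)..(2 * N + 1), triangleWave α / α ^ 2 =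
      (1 - 1 / (2 * N + 1)) - Real.log (Real.Wallis.W N) := by
  induction N with
  | zero => simp [Real.Wallis.W]
  | succ N ih =>
    have hN : (0 : ℝ) ≤ N := Nat.cast_nonneg N
    have hsplit : ∫ α in (1 : ℝ)..(2 * (N + 1 : ℕ) + 1), triangleWave α / α ^ 2 =
        (∫ α in (1 : ℝ)..(2 * N + 1), triangleWave α / α ^ 2) +
          ∫ α in (2 * (N + 1 : ℕ) - 1 : ℝ)..(2 * (N + 1 : ℕ) + 1), triangleWave α / α ^ 2 := by
      have e : (2 * ((N + 1 : ℕ) : ℝ) - 1) = 2 * N + 1 := by push_cast; ring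
      rw [e, intervalIntegral.integral_add_adjacent_intervals
        (intervalIntegrable_triangleWave_div_sq one_pos (by linarith))
        (intervalIntegrable_triangleWave_div_sq (by linarith) (by push_cast; linarith))]
    rw [hsplit, ih, integral_triangleWave_div_sq_period (N + 1) (by omega), Real.Wallis.W_succ,
      Real.log_mul (Real.Wallis.W_pos N).ne' (by positivity)]
    have q : ((2 * (N : ℝ) + 2) / (2 * N + 1) * ((2 * N + 2) / (2 * N + 3)))⁻¹ =
        1 - 1 / (4 * ((N : ℝ) + 1) ^ 2) := by
      have h1 : (2 * (N : ℝ) + 1) ≠ 0 := by positivity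
      have h2 : (2 * (N : ℝ) + 3) ≠ 0 := by positivity
      have h3 : (2 * (N : ℝ) + 2) ≠ 0 := by positivity
      have h4 : ((N : ℝ) + 1) ≠ 0 := by positivity
      field_simp
      ring
    have hW : Real.log ((2 * (N : ℝ) + 2) / (2 * N + 1) * ((2 * N + 2) / (2 * N + 3))) =
        -Real.log (1 - 1 / (4 * ((N + 1 : ℕ) : ℝ) ^ 2)) := by
      have e : (2 * (N : ℝ) + 2) / (2 * N + 1) * ((2 * N + 2) / (2 * N + 3)) =
          (1 - 1 / (4 * ((N + 1 : ℕ) : ℝ) ^ 2))⁻¹ := by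
        push_cast
        rw [← q, inv_inv]
      rw [e, Real.log_inv]
    rw [hW]
    push_cast
    ring

/-- **`∫_1^{2N+1} s(α)/α² dα → 1 + log(2/π)`** along the odd integers (Wallis: `W_N → π/2`,
`Real.Wallis.tendsto_W_nhds_pi_div_two`; "`∑_{n=1}^∞ log(1 − 1/(4n²)) = log(2/π)`" in §7).
[cite: BaluyotGoldstonSuriajayaTurnageButterbaugh2025, §7 (proof of Corollary 4)] -/
theorem tendsto_integral_triangleWave_div_sq_nat :
    Tendsto (fun N : ℕ ↦ ∫ α in (1 : ℝ)..(2 * N + 1), triangleWave α / α ^ 2) atTop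
      (𝓝 (1 + Real.log (2 / π))) := by
  have h1 : Tendsto (fun N : ℕ ↦ (1 : ℝ) - 1 / (2 * N + 1)) atTop (𝓝 (1 - 0)) := by
    refine tendsto_const_nhds.sub ?_
    refine tendsto_const_nhds.div_atTop ?_
    refine Tendsto.atTop_add ?_ tendsto_const_nhds
    exact tendsto_natCast_atTop_atTop.const_mul_atTop two_pos
  have h2 : Tendsto (fun N : ℕ ↦ Real.log (Real.Wallis.W N)) atTop (𝓝 (Real.log (π / 2))) :=
    (Real.continuousAt_log Real.pi_div_two_pos.ne').tendsto.comp
      Real.Wallis.tendsto_W_nhds_pi_div_two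
  have e : (1 : ℝ) + Real.log (2 / π) = (1 - 0) - Real.log (π / 2) := by
    rw [sub_zero, show (2 : ℝ) / π = (π / 2)⁻¹ by rw [inv_div], Real.log_inv]
    ring
  rw [e]
  refine (h1.sub h2).congr fun N ↦ ?_
  rw [integral_triangleWave_div_sq_eq N]

/-- **`∫_1^U s(α)/α² dα → 1 + log(2/π)` as `U → ∞`** (real `U`; the integrand is non-negative, so the
integral is monotone in `U` and is squeezed between its values at consecutive odd integers).
[cite: BaluyotGoldstonSuriajayaTurnageButterbaugh2025, §7 (proof of Corollary 4)] -/
theorem tendsto_integral_triangleWave_div_sq :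
    Tendsto (fun U : ℝ ↦ ∫ α in (1 : ℝ)..U, triangleWave α / α ^ 2) atTop (𝓝 (1 + Real.log (2 / π))) := by
  set I : ℝ → ℝ := fun U ↦ ∫ α in (1 : ℝ)..U, triangleWave α / α ^ 2 with hI
  -- monotonicity of `I` on `[1, ∞)`
  have hmono : ∀ u v : ℝ, 1 ≤ u → u ≤ v → I u ≤ I v := by
    intro u v hu huv
    simp only [hI]
    rw [← intervalIntegral.integral_add_adjacent_intervals
      (intervalIntegrable_triangleWave_div_sq one_pos hu)
      (intervalIntegrable_triangleWave_div_sq (by linarith) huv)]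
    have : 0 ≤ ∫ α in u..v, triangleWave α / α ^ 2 :=
      intervalIntegral.integral_nonneg huv fun x _ ↦ div_nonneg (triangleWave_nonneg x) (sq_nonneg x)
    linarith
  -- the index `N(U) = ⌊(U − 1)/2⌋₊ → ∞`
  have hN : Tendsto (fun U : ℝ ↦ ⌊(U - 1) / 2⌋₊) atTop atTop := by
    refine tendsto_nat_floor_atTop.comp ?_
    refine Tendsto.atTop_div_const two_pos ?_
    exact tendsto_atTop_add_const_right _ _ tendsto_id
  have hlow : Tendsto (fun U : ℝ ↦ I (2 * (⌊(U - 1) / 2⌋₊ : ℕ) + 1)) atTop (𝓝 (1 + Real.log (2 / π))) :=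
    tendsto_integral_triangleWave_div_sq_nat.comp hN
  have hup : Tendsto (fun U : ℝ ↦ I (2 * ((⌊(U - 1) / 2⌋₊ + 1 : ℕ) : ℝ) + 1)) atTop
      (𝓝 (1 + Real.log (2 / π))) :=
    tendsto_integral_triangleWave_div_sq_nat.comp ((tendsto_add_atTop_nat 1).comp hN)
  refine tendsto_of_tendsto_of_tendsto_of_le_of_le' hlow hup ?_ ?_
  · filter_upwards [eventually_ge_atTop (1 : ℝ)] with U hU
    have h0 : (0 : ℝ) ≤ (⌊(U - 1) / 2⌋₊ : ℕ) := Nat.cast_nonneg _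
    refine hmono _ _ (by linarith) ?_
    have := Nat.floor_le (by linarith : 0 ≤ (U - 1) / 2)
    linarith
  · filter_upwards [eventually_ge_atTop (1 : ℝ)] with U hU
    refine hmono _ _ hU ?_
    have := Nat.lt_floor_add_one ((U - 1) / 2)
    push_cast
    linarith

/-! ### The series over the even and the odd squares -/

/-- `Σ_k 1/(2k)² = ζ(2)/4 = π²/24` over `k ≥ 0` (the `k = 0` term is `0` in Lean). [folklore] -/
private theorem hasSum_even_aux :
    HasSum (fun k : ℕ ↦ (1 : ℝ) / (((2 * k : ℕ) : ℝ)) ^ 2) (π ^ 2 / 24) := by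
  have h := hasSum_zeta_two.mul_left (1 / 4)
  have e : (1 : ℝ) / 4 * (π ^ 2 / 6) = π ^ 2 / 24 := by ring
  have ef : (fun k : ℕ ↦ (1 : ℝ) / 4 * (1 / (k : ℝ) ^ 2)) = fun k : ℕ ↦ (1 : ℝ) / (((2 * k : ℕ) : ℝ)) ^ 2 := by
    funext k; push_cast; ring
  rw [e, ef] at h
  exact h

/-- **`Σ_{n≥1} 1/(2n)² = π²/24`** ("`(1/4) ζ(2)`" in §7, proof of Corollary 4 (ii)), indexed `n = k + 1`.
[cite: BaluyotGoldstonSuriajayaTurnageButterbaugh2025, §7 (proof of Corollary 4)] -/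
theorem hasSum_one_div_even_sq : HasSum (fun k : ℕ ↦ 1 / (2 * ((k : ℝ) + 1)) ^ 2) (π ^ 2 / 24) := by
  have h1 := (hasSum_nat_add_iff' 1).mpr hasSum_even_aux
  rw [Finset.sum_range_one] at h1
  have e : (fun k : ℕ ↦ (1 : ℝ) / (((2 * (k + 1) : ℕ) : ℝ)) ^ 2) = fun k : ℕ ↦ 1 / (2 * ((k : ℝ) + 1)) ^ 2 := by
    funext k; push_cast; ring
  rw [e] at h1
  have e2 : π ^ 2 / 24 - (1 : ℝ) / (((2 * 0 : ℕ) : ℝ)) ^ 2 = π ^ 2 / 24 := by simp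
  rw [e2] at h1
  exact h1

/-- **`Σ_{n≥1} 1/(2n−1)² = π²/8`** (= `ζ(2) − ζ(2)/4`, the "`(3/2)·ζ(2)`" bookkeeping of §7, proof of
Corollary 4 (ii)), indexed `2n − 1 = 2k + 1`, `k ≥ 0`.
[cite: BaluyotGoldstonSuriajayaTurnageButterbaugh2025, §7 (proof of Corollary 4)] -/
theorem hasSum_one_div_odd_sq : HasSum (fun k : ℕ ↦ 1 / (2 * (k : ℝ) + 1) ^ 2) (π ^ 2 / 8) := by
  set f : ℕ → ℝ := fun n ↦ (1 : ℝ) / (n : ℝ) ^ 2 with hf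
  have he : HasSum (fun k : ℕ ↦ f (2 * k)) (π ^ 2 / 24) := hasSum_even_aux
  have hinj : Function.Injective (fun k : ℕ ↦ 2 * k + 1) := fun a b hab ↦ by
    simp only at hab; omega
  have hs : Summable (fun k : ℕ ↦ f (2 * k + 1)) := hasSum_zeta_two.summable.comp_injective hinj
  obtain ⟨b, hb⟩ := hs
  have heo := HasSum.even_add_odd he hb
  have hb' : b = π ^ 2 / 8 := by
    have := heo.unique hasSum_zeta_two
    linarith
  rw [hb'] at hb
  have e : (fun k : ℕ ↦ f (2 * k + 1)) = fun k : ℕ ↦ 1 / (2 * (k : ℝ) + 1) ^ 2 := by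
    funext k; simp only [hf]; push_cast; ring
  rw [e] at hb
  exact hb

/-- `Σ_{n≥2} 1/(2n−1)² = π²/8 − 1`: the odd squares from `3` on (the odd atoms `|K| ≥ 3` of `𝓕`), indexed
`2n − 1 = 2k + 3`. [cite: BaluyotGoldstonSuriajayaTurnageButterbaugh2025, §7 (proof of Corollary 4)] -/
theorem hasSum_one_div_odd_sq_from_three :
    HasSum (fun k : ℕ ↦ 1 / (2 * (k : ℝ) + 3) ^ 2) (π ^ 2 / 8 - 1) := by
  have h1 := (hasSum_nat_add_iff' 1).mpr hasSum_one_div_odd_sq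
  rw [Finset.sum_range_one] at h1
  have e : (fun k : ℕ ↦ (1 : ℝ) / (2 * ((k + 1 : ℕ) : ℝ) + 1) ^ 2) = fun k : ℕ ↦ 1 / (2 * (k : ℝ) + 3) ^ 2 := by
    funext k; push_cast; ring
  rw [e] at h1
  have e2 : π ^ 2 / 8 - (1 : ℝ) / (2 * ((0 : ℕ) : ℝ) + 1) ^ 2 = π ^ 2 / 8 - 1 := by simp
  rw [e2] at h1
  exact h1

/-! ### The constant of Corollary 4 (ii) -/

/-- **The constant of Corollary 4 (ii)**: with the mass `2(p_0−1)` at every odd integer `≥ 1` (the one at `1`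
one-sided from the right), unit mass at the even integers `≥ 2`, and the sawtooth part,
`2(p_0−1)·(π²/8) + π²/24 + (1 + log(2/π)) = 1 + (3/2(p_0−1) + 1/4)·π²/6 + log(2/π)` — the value printed in
Corollary 4 (ii). [cite: BaluyotGoldstonSuriajayaTurnageButterbaugh2025, Corollary 4 (ii)] -/
theorem corollary4_constant (p₀ : ℝ) :
    2 * (p₀ - 1) * (π ^ 2 / 8) + π ^ 2 / 24 + (1 + Real.log (2 / π)) =
      1 + (3 / 2 * (p₀ - 1) + 1 / 4) * (π ^ 2 / 6) + Real.log (2 / π) := by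
  ring


/-! ### The atom sums of `𝓕` on `[1, U]` in the shape of `AH.calFIntegral`

For `a = 1` and `⌈U⌉ = N + 1` the two sums of `AH.calFIntegral P₀ 1 U g` run over
`(Finset.Ioo 1 (N+1)).filter (Even ∧ ≠ 0)` and `(Finset.Ioo 1 (N+1)).filter (Odd ∧ 3 ≤ |·|)` (integers `m`);
with `g(m) = 1/m²` these are the partial sums "`∑ 1/(2n)²`" and "`∑_{n≥2} 1/(2n−1)²`" of §7, and they
converge to `π²/24` and `π²/8 − 1` as `N → ∞`. -/

/-- Re-indexing: a `ℤ`-indexed sum over `(Finset.Ioo 1 (N+1)).filter P` is the `ℕ`-indexed partial sum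
`∑_{n < N+1} [P n] f n`, provided `P n ⇒ 1 < n` on naturals. [folklore] -/
private theorem sum_Ioo_filter_eq_sum_range (P : ℤ → Prop) [DecidablePred P]
    (hP : ∀ n : ℕ, P n → 1 < n) (f : ℤ → ℝ) (N : ℕ) :
    ∑ m ∈ (Finset.Ioo (1 : ℤ) (N + 1)).filter P, f m =
      ∑ n ∈ Finset.range (N + 1), if P n then f n else 0 := by
  rw [← Finset.sum_filter]
  refine Finset.sum_nbij' (fun m ↦ m.toNat) (fun n ↦ (n : ℤ)) ?_ ?_ ?_ ?_ ?_
  · intro m hm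
    simp only [Finset.mem_filter, Finset.mem_Ioo, Finset.mem_range] at hm ⊢
    obtain ⟨⟨h1, h2⟩, hPm⟩ := hm
    have e : ((m.toNat : ℕ) : ℤ) = m := Int.toNat_of_nonneg (by omega)
    refine ⟨?_, by rwa [e]⟩
    have : ((m.toNat : ℕ) : ℤ) < N + 1 := by rw [e]; exact h2
    exact_mod_cast this
  · intro n hn
    simp only [Finset.mem_filter, Finset.mem_range, Finset.mem_Ioo] at hn ⊢
    obtain ⟨h1, hPn⟩ := hn
    have := hP n hPn
    exact ⟨⟨by exact_mod_cast this, by exact_mod_cast h1⟩, hPn⟩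
  · intro m hm
    simp only [Finset.mem_filter, Finset.mem_Ioo] at hm
    exact Int.toNat_of_nonneg (by omega)
  · intro n _
    exact Int.toNat_natCast n
  · intro m hm
    simp only [Finset.mem_filter, Finset.mem_Ioo] at hm
    rw [Int.toNat_of_nonneg (by omega)]

/-- **The even atoms**: `∑_{m ∈ (1, N+1) ∩ ℤ, m even, m ≠ 0} 1/m² → π²/24` as `N → ∞` — the filter is the one
of `AH.calFIntegral` ("`(1/4) ζ(2)`" in §7, proof of Corollary 4 (ii)).
[cite: BaluyotGoldstonSuriajayaTurnageButterbaugh2025, §7 (proof of Corollary 4)] -/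
theorem tendsto_sum_Ioo_even :
    Tendsto (fun N : ℕ ↦ ∑ m ∈ (Finset.Ioo (1 : ℤ) (N + 1)).filter (fun m ↦ Even m ∧ m ≠ 0),
      (1 : ℝ) / (m : ℝ) ^ 2) atTop (𝓝 (π ^ 2 / 24)) := by
  set f : ℤ → ℝ := fun m ↦ (1 : ℝ) / (m : ℝ) ^ 2 with hf
  set F : ℕ → ℝ := fun n ↦ if Even (n : ℤ) ∧ (n : ℤ) ≠ 0 then f n else 0 with hF
  set g : ℕ → ℕ := fun k ↦ 2 * (k + 1) with hg
  have hginj : Function.Injective g := fun a b h ↦ by simp only [hg] at h; omega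
  have hFg : F ∘ g = fun k : ℕ ↦ 1 / (2 * ((k : ℝ) + 1)) ^ 2 := by
    funext k
    simp only [Function.comp_apply, hF, hg, hf]
    rw [if_pos ⟨⟨(k : ℤ) + 1, by push_cast; ring⟩, by push_cast; positivity⟩]
    push_cast
    ring
  have hoff : ∀ x ∉ Set.range g, F x = 0 := by
    intro x hx
    simp only [hF]
    rw [if_neg]
    rintro ⟨⟨j, hj⟩, hx0⟩
    apply hx
    refine ⟨x / 2 - 1, ?_⟩
    simp only [hg]
    omega
  have hsum : HasSum F (π ^ 2 / 24) :=
    (hginj.hasSum_iff hoff).mp (by rw [hFg]; exact hasSum_one_div_even_sq)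
  have ht := hsum.tendsto_sum_nat.comp (tendsto_add_atTop_nat 1)
  refine ht.congr fun N ↦ ?_
  simp only [Function.comp_apply]
  refine (sum_Ioo_filter_eq_sum_range (fun m ↦ Even m ∧ m ≠ 0) (fun n hn ↦ ?_) f N).symm
  obtain ⟨⟨j, hj⟩, h0⟩ := hn
  omega

/-- **The odd atoms**: `∑_{m ∈ (1, N+1) ∩ ℤ, m odd, 3 ≤ |m|} 1/m² → π²/8 − 1` as `N → ∞` — the filter is the
one of `AH.calFIntegral` ("`2(P_0−1) ∑ 1/(2n−1)²`" in §7, proof of Corollary 4 (ii), minus its `n = 1` term,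
which is the one-sided mass at `1`). [cite: BaluyotGoldstonSuriajayaTurnageButterbaugh2025, §7 (proof of Corollary 4)] -/
theorem tendsto_sum_Ioo_odd :
    Tendsto (fun N : ℕ ↦ ∑ m ∈ (Finset.Ioo (1 : ℤ) (N + 1)).filter (fun m ↦ Odd m ∧ 3 ≤ |m|),
      (1 : ℝ) / (m : ℝ) ^ 2) atTop (𝓝 (π ^ 2 / 8 - 1)) := by
  set f : ℤ → ℝ := fun m ↦ (1 : ℝ) / (m : ℝ) ^ 2 with hf
  set F : ℕ → ℝ := fun n ↦ if Odd (n : ℤ) ∧ 3 ≤ |(n : ℤ)| then f n else 0 with hF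
  set g : ℕ → ℕ := fun k ↦ 2 * k + 3 with hg
  have hginj : Function.Injective g := fun a b h ↦ by simp only [hg] at h; omega
  have hFg : F ∘ g = fun k : ℕ ↦ 1 / (2 * (k : ℝ) + 3) ^ 2 := by
    funext k
    simp only [Function.comp_apply, hF, hg, hf]
    have habs : |(((2 * k + 3 : ℕ)) : ℤ)| = ((2 * k + 3 : ℕ) : ℤ) := abs_of_nonneg (by positivity)
    rw [if_pos ⟨⟨(k : ℤ) + 1, by push_cast; ring⟩, by rw [habs]; push_cast; omega⟩]
    push_cast
    ring
  have hoff : ∀ x ∉ Set.range g, F x = 0 := by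
    intro x hx
    simp only [hF]
    rw [if_neg]
    rintro ⟨⟨j, hj⟩, hx3⟩
    rw [abs_of_nonneg (by positivity)] at hx3
    apply hx
    refine ⟨(x - 3) / 2, ?_⟩
    simp only [hg]
    omega
  have hsum : HasSum F (π ^ 2 / 8 - 1) :=
    (hginj.hasSum_iff hoff).mp (by rw [hFg]; exact hasSum_one_div_odd_sq_from_three)
  have ht := hsum.tendsto_sum_nat.comp (tendsto_add_atTop_nat 1)
  refine ht.congr fun N ↦ ?_
  simp only [Function.comp_apply]
  refine (sum_Ioo_filter_eq_sum_range (fun m ↦ Odd m ∧ 3 ≤ |m|) (fun n hn ↦ ?_) f N).symm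
  obtain ⟨_, h3⟩ := hn
  rw [abs_of_nonneg (by positivity)] at h3
  omega

end Literature.NumberTheory.LFunctions.AH.Cor4

end
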